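import Summits.Ventures.LatticeQCDFlow.Scaling.LumpedStarCollectorFloor

/-!
HONEST FRAMING: exact (Metropolis-corrected) sampling algorithms for lattice gauge theory; figures
of merit are autocorrelation/cost numbers at stated couplings and volumes; no continuum-physics
claim.

# LumpedStarPairLumping — WITH ONE DISTINGUISHED CONTENT `u` (`acc(u,·) = α`, `acc(·,u) = β` OFF `u`) THE PAIR (COLD `u`-COUNT `G`, HUB INDICATOR `𝟙{hub = u}`) OF THE
# LUMPED STAR'S STEP CHAIN MOVES AUTONOMOUSLY IN EXPECTATION: FOR `Φ = F(G) + 𝟙{hub = u}·H(G)`, `(SΦ)(x)` IS AN EXPLICIT FUNCTION OF `(G(x), 𝟙{hub x = u})`; HENCE THE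
# DEFECT OF `Φ` AGAINST `1 − Λ/K` AND ITS JUMPS ARE READ OFF TWO FUNCTIONS OF `G` (lean-2 GEN-46, ours)

Venture-side (OURS).  Cell `lqcd-flow` (pub-lqcd), unit `pub-lqcd-lean-2-g46`, 2026-08-31.  Chapter AF (the law-free `½·log K` with persistence), file 4 — X5's step chain
`S = σA + (1−σ)B` of the lumped star (state = (hub content, composition `N` of `K+1` particles); `A` one swap attempt of the hub with a uniformly chosen cold particle accepted with
`acc`; `B` the redraw of the hub particle from `μ_0`) and the cold `u`-count `G = N(u) − 𝟙{hub = u}` of chapter AE file 2.  HYPOTHESIS on the persistence pattern: for the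
distinguished content `u`, `acc(u,w) = α` and `acc(w,u) = β` for all `w ≠ u` — two contents, or `W` constant off `u` (one persistent ∕ one volatile content type among arbitrarily
many others of equal persistence; `α = min{1, W_u/W₂}`, `β = min{1, W₂/W_u}`).  Swaps between two non-`u` contents change neither `G` nor the hub indicator, whatever their
acceptance, so for every `F, H : ℕ → ℝ` and `Φ(x) = F(G x) + 𝟙{hub x = u}H(G x)`:
`(AΦ)(x) = (1 − α(K−G)/K)(F(G)+H(G)) + α((K−G)/K)F(G+1)` at a hub `= u`, `= β(G/K)(F(G−1)+H(G−1)) + (1 − βG/K)F(G)` at a hub `≠ u`; `(BΦ)(x) = F(G) + μ_0(u)H(G)`.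
Hypothesis-equations only, no definitions.

* §1 `pair_coldCount_swap_from_u` ∕ `_to_u` ∕ `_kept` (how `G` moves under a swap), `pair_pattern_of_persistence` (`W` constant off `u` gives the pattern), **`pair_swap_expect`**, **`pair_redraw_expect`**, **`pair_step_expect`**; §2 **`pair_step_defect`** — if
  `|σα((K−G)/K)(F(G+1) − F(G) − H(G)) − (1−σ)(1−μ_0(u))H(G) + (Λ/K)(F(G)+H(G))| ≤ δ` and `|σβ(G/K)(F(G−1) + H(G−1) − F(G)) + (1−σ)μ_0(u)H(G) + (Λ/K)F(G)| ≤ δ` for all `G ≤ K`,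
  then **`|(SΦ)(x) − (1 − Λ/K)Φ(x)| ≤ δ` for every state**; **`pair_step_sq_increment`** — if `|F(G+1) − F(G)| ≤ J₁` (`G ≤ K`) and `|H(G)| ≤ J₂` (`G ≤ K`) then
  `Σ_y S(x,y)(Φ y − Φ x)² ≤ (J₁ + J₂)²`.

Reading (no numerics implied): the lumpability that makes chapter AF's approximate eigenfunction a statistic of the lumped star itself; with file 3b's defect `4c(1+c)e^c/K` and
jumps, file 5 runs file 1's Wilson-with-defect floor.  Literature grade (cell rule): OWN, elementary bookkeeping on X5; nothing cited; no new bib keys.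
-/

noncomputable section

open Finset Function
open Literature.Probability.MarkovChains

namespace Summit.Ventures.LatticeQCDFlow.Scaling

section PairLumping
variable {X : Type*} [Fintype X] [DecidableEq X] {S : Type*} [Fintype S] [DecidableEq S]
variable {hub : X → S} {comp : X → S → ℕ} {K : ℕ} {μ0 : S → ℝ} {σ : ℝ} {acc : S → S → ℝ} {Kh : (S → ℕ) → S → S → ℝ}
variable {Ast Bst Sst : X → X → ℝ} {u : S} {α β : ℝ} {Gc : X → ℕ} {F H : ℕ → ℝ} {Φ : X → ℝ}

/-! ## §1 The pair moves autonomously in expectation -/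

omit [Fintype X] [DecidableEq X] [Fintype S] in
/-- Within a composition, from a hub `= u` to a hub `≠ u` the cold `u`-count rises by one. [ours] -/
theorem pair_coldCount_swap_from_u (hhub : ∀ x, comp x (hub x) ≠ 0) (hG : ∀ x, Gc x = comp x u - (if hub x = u then 1 else 0))
    {x y : X} (hc : comp y = comp x) (hx : hub x = u) (hy : hub y ≠ u) : Gc y = Gc x + 1 := by
  rw [hG, hG, hc, if_pos hx, if_neg hy]
  have h1 : 1 ≤ comp x u := by rw [← hx]; exact Nat.one_le_iff_ne_zero.mpr (hhub x)
  omega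

omit [Fintype X] [DecidableEq X] [Fintype S] in
/-- Within a composition, from a hub `≠ u` to a hub `= u` the cold `u`-count falls by one. [ours] -/
theorem pair_coldCount_swap_to_u (hhub : ∀ x, comp x (hub x) ≠ 0) (hG : ∀ x, Gc x = comp x u - (if hub x = u then 1 else 0))
    {x y : X} (hc : comp y = comp x) (hx : hub x ≠ u) (hy : hub y = u) : Gc y + 1 = Gc x := by
  rw [hG, hG, hc, if_neg hx, if_pos hy]
  have h1 : 1 ≤ comp x u := by rw [← hc, ← hy]; exact Nat.one_le_iff_ne_zero.mpr (hhub y)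
  omega

omit [Fintype X] [DecidableEq X] [Fintype S] in
/-- Within a composition, between two hubs `≠ u` (or two hubs `= u`) the cold `u`-count is kept. [ours] -/
theorem pair_coldCount_swap_kept (hG : ∀ x, Gc x = comp x u - (if hub x = u then 1 else 0))
    {x y : X} (hc : comp y = comp x) (hxy : (hub x = u) ↔ (hub y = u)) : Gc y = Gc x := by
  rw [hG, hG, hc]
  by_cases hx : hub x = u
  · rw [if_pos hx, if_pos (hxy.mp hx)]
  · rw [if_neg hx, if_neg (fun h => hx (hxy.mpr h))]

omit [DecidableEq X] in
/-- **THE SWAP STEP ON THE PAIR:** for `Φ = F(G) + 𝟙{hub = u}H(G)`,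
`(AΦ)(x) = (1 − α(K−G)/K)(F(G)+H(G)) + α((K−G)/K)F(G+1)` at a hub `= u` and `= β(G/K)(F(G−1)+H(G−1)) + (1 − βG/K)F(G)` at a hub `≠ u`. [ours] -/
theorem pair_swap_expect (hinj : ∀ x x', hub x = hub x' → comp x = comp x' → x = x')
    (hsurj : ∀ (z : S) (N : S → ℕ), ∑ v, N v = K + 1 → N z ≠ 0 → ∃ x, hub x = z ∧ comp x = N) (hhub : ∀ x, comp x (hub x) ≠ 0)
    (hsum : ∀ x, ∑ v, comp x v = K + 1)
    (hKoff : ∀ N h v, h ≠ v → Kh N h v = if N h = 0 then 0 else (N v : ℝ) / K * acc h v) (hKdiag : ∀ N h, Kh N h h = 1 - ∑ v ∈ univ.erase h, Kh N h v)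
    (hA : ∀ x x', Ast x x' = if comp x' = comp x then Kh (comp x) (hub x) (hub x') else 0)
    (hαu : ∀ w, w ≠ u → acc u w = α) (hβu : ∀ w, w ≠ u → acc w u = β)
    (hG : ∀ x, Gc x = comp x u - (if hub x = u then 1 else 0)) (hΦ : ∀ x, Φ x = F (Gc x) + (if hub x = u then H (Gc x) else 0)) (x : X) :
    ∑ x', Ast x x' * Φ x'
      = if hub x = u then (1 - α * (((K : ℝ) - Gc x) / K)) * (F (Gc x) + H (Gc x)) + α * (((K : ℝ) - Gc x) / K) * F (Gc x + 1)
        else β * ((Gc x : ℝ) / K) * (F (Gc x - 1) + H (Gc x - 1)) + (1 - β * ((Gc x : ℝ) / K)) * F (Gc x) := by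
  classical
  set N : S → ℕ := comp x with hN
  -- on the fibre `comp x' = N`, `Φ x'` is a function of `hub x'`
  set φ : S → ℝ := fun v => F (N u - (if v = u then 1 else 0)) + (if v = u then H (N u - 1) else 0) with hφ
  have hfib : ∀ x', comp x' = N → Φ x' = φ (hub x') := by
    intro x' hc
    rw [hΦ, hG x', hc]
    by_cases hv : hub x' = u
    · simp only [hφ, if_pos hv]
    · simp only [hφ, if_neg hv]
  have e : ∀ x', Ast x x' * Φ x' = if comp x' = N then (fun v => Kh N (hub x) v * φ v) (hub x') else 0 := by
    intro x'
    rw [hA]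
    by_cases hc : comp x' = comp x
    · rw [if_pos hc, if_pos hc, hfib x' hc]
    · rw [if_neg hc, if_neg hc, zero_mul]
  rw [sum_congr rfl fun x' _ => e x', star_sum_fiber hinj hsurj hhub N (hsum x) (fun v => Kh N (hub x) v * φ v)]
  -- drop the indicator `N v ≠ 0` (legality is closed)
  have hNh : N (hub x) ≠ 0 := hhub x
  have e2 : ∑ v, (if N v = 0 then (0 : ℝ) else Kh N (hub x) v * φ v) = ∑ v, Kh N (hub x) v * φ v := by
    refine sum_congr rfl fun v _ => ?_
    by_cases hv : N v = 0
    · rw [if_pos hv]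
      have hne : hub x ≠ v := fun e => hNh (e ▸ hv)
      rw [starHub_closed (hKoff N) hNh hv, zero_mul]
    · rw [if_neg hv]
  rw [e2, ← Finset.add_sum_erase univ _ (mem_univ u)]
  -- `Σ_{v ≠ u} N v = (K+1) − N u`
  have hrest : ∑ v ∈ univ.erase u, (N v : ℝ) = (K : ℝ) + 1 - N u := by
    rw [Finset.sum_erase_eq_sub (mem_univ u), ← Nat.cast_sum, hsum x]; push_cast; ring
  have hφu : φ u = F (N u - 1) + H (N u - 1) := by simp only [hφ, if_true]
  have hφv : ∀ v, v ≠ u → φ v = F (N u) := fun v hv => by simp only [hφ, if_neg hv, Nat.sub_zero, add_zero]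
  by_cases hx : hub x = u
  · -- hub `= u`: `G = N u − 1`
    rw [if_pos hx]
    have hGx : Gc x = N u - 1 := by rw [hG, if_pos hx]
    have hNu1 : 1 ≤ N u := by rw [← hx]; exact Nat.one_le_iff_ne_zero.mpr hNh
    have hGc : (Gc x : ℝ) = (N u : ℝ) - 1 := by rw [hGx, Nat.cast_sub hNu1, Nat.cast_one]
    have hG1 : Gc x + 1 = N u := by rw [hGx]; omega
    rw [hx]
    have hoff : ∀ v ∈ univ.erase u, Kh N u v * φ v = α / K * F (N u) * (N v : ℝ) := by
      intro v hv
      have hvu : v ≠ u := (mem_erase.mp hv).1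
      rw [hKoff N u v (Ne.symm hvu), if_neg (hx ▸ hNh), hαu v hvu, hφv v hvu]; ring
    have hoffK : ∀ v ∈ univ.erase u, Kh N u v = α / K * (N v : ℝ) := by
      intro v hv
      have hvu : v ≠ u := (mem_erase.mp hv).1
      rw [hKoff N u v (Ne.symm hvu), if_neg (hx ▸ hNh), hαu v hvu]; ring
    rw [sum_congr rfl hoff, ← mul_sum, hrest, hKdiag N u, sum_congr rfl hoffK, ← mul_sum, hrest, hφu, hG1, hGc, hGx]
    field_simp
    ring
  · -- hub `≠ u`: `G = N u`
    rw [if_neg hx]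
    have hGx : Gc x = N u := by rw [hG, if_neg hx, Nat.sub_zero]
    rw [hGx]
    have hoff : ∀ v ∈ univ.erase u, Kh N (hub x) v * φ v = Kh N (hub x) v * F (N u) := by
      intro v hv
      rw [hφv v (mem_erase.mp hv).1]
    have hKu : Kh N (hub x) u = β * ((N u : ℝ) / K) := by
      rw [hKoff N (hub x) u hx, if_neg hNh, hβu (hub x) hx]; ring
    have hrow : ∑ v ∈ univ.erase u, Kh N (hub x) v = 1 - Kh N (hub x) u := by
      rw [Finset.sum_erase_eq_sub (mem_univ u), starHub_rowsum (hKdiag N) (hub x)]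
    rw [sum_congr rfl hoff, ← sum_mul, hrow, hKu, hφu]

omit [DecidableEq X] in
/-- **THE REDRAW ON THE PAIR:** `(BΦ)(x) = F(G) + μ_0(u)H(G)` (the hub particle moves with the hub: `G` is kept, the new hub is `u` with probability `μ_0(u)`). [ours] -/
theorem pair_redraw_expect (hinj : ∀ x x', hub x = hub x' → comp x = comp x' → x = x')
    (hsurj : ∀ (z : S) (N : S → ℕ), ∑ v, N v = K + 1 → N z ≠ 0 → ∃ x, hub x = z ∧ comp x = N) (hhub : ∀ x, comp x (hub x) ≠ 0)
    (hsum : ∀ x, ∑ v, comp x v = K + 1) (hμ1 : ∑ v, μ0 v = 1)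
    (hB : ∀ x x', Bst x x' = μ0 (hub x') * (if comp x' + Pi.single (hub x) 1 = comp x + Pi.single (hub x') 1 then 1 else 0))
    (hG : ∀ x, Gc x = comp x u - (if hub x = u then 1 else 0)) (hΦ : ∀ x, Φ x = F (Gc x) + (if hub x = u then H (Gc x) else 0)) (x : X) :
    ∑ x', Bst x x' * Φ x' = F (Gc x) + μ0 u * H (Gc x) := by
  classical
  -- on the redraw fibre `G` is kept
  have hkeep : ∀ x', comp x' + Pi.single (hub x) 1 = comp x + Pi.single (hub x') 1 → Gc x' = Gc x := by
    intro x' hr; rw [hG, hG]; exact coldCount_redraw hhub u hr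
  have e : ∀ x', Bst x x' * Φ x' = F (Gc x) * Bst x x' + H (Gc x) * (μ0 u * (if hub x' = u ∧ comp x' + Pi.single (hub x) 1 = comp x + Pi.single u 1 then (1 : ℝ) else 0)) := by
    intro x'
    rw [hB]
    by_cases hr : comp x' + Pi.single (hub x) 1 = comp x + Pi.single (hub x') 1
    · rw [if_pos hr, mul_one, hΦ, hkeep x' hr]
      by_cases hv : hub x' = u
      · rw [if_pos hv, hv, if_pos ⟨rfl, hv ▸ hr⟩]; ring
      · rw [if_neg hv, if_neg (fun h => hv h.1)]; ring
    · rw [if_neg hr, mul_zero]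
      have : ¬ (hub x' = u ∧ comp x' + Pi.single (hub x) 1 = comp x + Pi.single u 1) := fun h => hr (h.1.symm ▸ h.2)
      rw [if_neg this]; ring
  rw [sum_congr rfl fun x' _ => e x', sum_add_distrib, ← mul_sum, ← mul_sum, ← mul_sum, starStep_redraw_rowsum hinj hsurj hhub hsum hμ1 hB x]
  rw [← Finset.sum_filter, sum_const, nsmul_eq_mul, mul_one, star_redraw_fiber_card hinj hsurj hhub hsum x u]
  ring

omit [DecidableEq X] in
/-- **THE STEP CHAIN ON THE PAIR:** `(SΦ)(x) = σ(AΦ)(x) + (1−σ)(BΦ)(x)` with the two values of files `pair_swap_expect` ∕ `pair_redraw_expect`. [ours] -/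
theorem pair_step_expect (hinj : ∀ x x', hub x = hub x' → comp x = comp x' → x = x')
    (hsurj : ∀ (z : S) (N : S → ℕ), ∑ v, N v = K + 1 → N z ≠ 0 → ∃ x, hub x = z ∧ comp x = N) (hhub : ∀ x, comp x (hub x) ≠ 0)
    (hsum : ∀ x, ∑ v, comp x v = K + 1) (hμ1 : ∑ v, μ0 v = 1)
    (hKoff : ∀ N h v, h ≠ v → Kh N h v = if N h = 0 then 0 else (N v : ℝ) / K * acc h v) (hKdiag : ∀ N h, Kh N h h = 1 - ∑ v ∈ univ.erase h, Kh N h v)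
    (hA : ∀ x x', Ast x x' = if comp x' = comp x then Kh (comp x) (hub x) (hub x') else 0)
    (hB : ∀ x x', Bst x x' = μ0 (hub x') * (if comp x' + Pi.single (hub x) 1 = comp x + Pi.single (hub x') 1 then 1 else 0))
    (hS : ∀ x x', Sst x x' = σ * Ast x x' + (1 - σ) * Bst x x')
    (hαu : ∀ w, w ≠ u → acc u w = α) (hβu : ∀ w, w ≠ u → acc w u = β)
    (hG : ∀ x, Gc x = comp x u - (if hub x = u then 1 else 0)) (hΦ : ∀ x, Φ x = F (Gc x) + (if hub x = u then H (Gc x) else 0)) (x : X) :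
    ∑ x', Sst x x' * Φ x'
      = σ * (if hub x = u then (1 - α * (((K : ℝ) - Gc x) / K)) * (F (Gc x) + H (Gc x)) + α * (((K : ℝ) - Gc x) / K) * F (Gc x + 1)
          else β * ((Gc x : ℝ) / K) * (F (Gc x - 1) + H (Gc x - 1)) + (1 - β * ((Gc x : ℝ) / K)) * F (Gc x))
        + (1 - σ) * (F (Gc x) + μ0 u * H (Gc x)) := by
  have e : ∀ x', Sst x x' * Φ x' = σ * (Ast x x' * Φ x') + (1 - σ) * (Bst x x' * Φ x') := fun x' => by rw [hS]; ring
  rw [sum_congr rfl fun x' _ => e x', sum_add_distrib, ← mul_sum, ← mul_sum,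
    pair_swap_expect hinj hsurj hhub hsum hKoff hKdiag hA hαu hβu hG hΦ x, pair_redraw_expect hinj hsurj hhub hsum hμ1 hB hG hΦ x]

/-! ## §2 The defect and the jumps are read off two functions of `G` -/

omit [DecidableEq X] in
/-- **THE DEFECT OF `Φ` AGAINST `1 − Λ/K`:** if for all `G ≤ K`
`|σα((K−G)/K)(F(G+1) − F(G) − H(G)) − (1−σ)(1−μ_0(u))H(G) + (Λ/K)(F(G)+H(G))| ≤ δ` and `|σβ(G/K)(F(G−1) + H(G−1) − F(G)) + (1−σ)μ_0(u)H(G) + (Λ/K)F(G)| ≤ δ`,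
then **`|(SΦ)(x) − (1 − Λ/K)Φ(x)| ≤ δ`** for every state `x`. [ours] -/
theorem pair_step_defect (hinj : ∀ x x', hub x = hub x' → comp x = comp x' → x = x')
    (hsurj : ∀ (z : S) (N : S → ℕ), ∑ v, N v = K + 1 → N z ≠ 0 → ∃ x, hub x = z ∧ comp x = N) (hhub : ∀ x, comp x (hub x) ≠ 0)
    (hsum : ∀ x, ∑ v, comp x v = K + 1) (hμ1 : ∑ v, μ0 v = 1)
    (hKoff : ∀ N h v, h ≠ v → Kh N h v = if N h = 0 then 0 else (N v : ℝ) / K * acc h v) (hKdiag : ∀ N h, Kh N h h = 1 - ∑ v ∈ univ.erase h, Kh N h v)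
    (hA : ∀ x x', Ast x x' = if comp x' = comp x then Kh (comp x) (hub x) (hub x') else 0)
    (hB : ∀ x x', Bst x x' = μ0 (hub x') * (if comp x' + Pi.single (hub x) 1 = comp x + Pi.single (hub x') 1 then 1 else 0))
    (hS : ∀ x x', Sst x x' = σ * Ast x x' + (1 - σ) * Bst x x')
    (hαu : ∀ w, w ≠ u → acc u w = α) (hβu : ∀ w, w ≠ u → acc w u = β)
    (hG : ∀ x, Gc x = comp x u - (if hub x = u then 1 else 0)) (hΦ : ∀ x, Φ x = F (Gc x) + (if hub x = u then H (Gc x) else 0))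
    {Λ δ : ℝ}
    (hE1 : ∀ G : ℕ, G ≤ K → |σ * α * (((K : ℝ) - G) / K) * (F (G + 1) - F G - H G) - (1 - σ) * (1 - μ0 u) * H G + Λ / K * (F G + H G)| ≤ δ)
    (hE0 : ∀ G : ℕ, G ≤ K → |σ * β * ((G : ℝ) / K) * (F (G - 1) + H (G - 1) - F G) + (1 - σ) * μ0 u * H G + Λ / K * F G| ≤ δ) (x : X) :
    |∑ x', Sst x x' * Φ x' - (1 - Λ / K) * Φ x| ≤ δ := by
  have hGK : Gc x ≤ K := by rw [hG]; exact coldCount_le hhub hsum u x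
  rw [pair_step_expect hinj hsurj hhub hsum hμ1 hKoff hKdiag hA hB hS hαu hβu hG hΦ x, hΦ x]
  by_cases hx : hub x = u
  · rw [if_pos hx, if_pos hx]
    have e : σ * ((1 - α * (((K : ℝ) - Gc x) / K)) * (F (Gc x) + H (Gc x)) + α * (((K : ℝ) - Gc x) / K) * F (Gc x + 1)) + (1 - σ) * (F (Gc x) + μ0 u * H (Gc x))
          - (1 - Λ / K) * (F (Gc x) + H (Gc x))
        = σ * α * (((K : ℝ) - Gc x) / K) * (F (Gc x + 1) - F (Gc x) - H (Gc x)) - (1 - σ) * (1 - μ0 u) * H (Gc x) + Λ / K * (F (Gc x) + H (Gc x)) := by ring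
    rw [e]; exact hE1 (Gc x) hGK
  · rw [if_neg hx, if_neg hx, add_zero]
    have e : σ * (β * ((Gc x : ℝ) / K) * (F (Gc x - 1) + H (Gc x - 1)) + (1 - β * ((Gc x : ℝ) / K)) * F (Gc x)) + (1 - σ) * (F (Gc x) + μ0 u * H (Gc x))
          - (1 - Λ / K) * F (Gc x)
        = σ * β * ((Gc x : ℝ) / K) * (F (Gc x - 1) + H (Gc x - 1) - F (Gc x)) + (1 - σ) * μ0 u * H (Gc x) + Λ / K * F (Gc x) := by ring
    rw [e]; exact hE0 (Gc x) hGK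

omit [Fintype X] [DecidableEq X] in
/-- **THE JUMPS OF `Φ`:** if `|F(G+1) − F(G)| ≤ J₁` and `|H(G)| ≤ J₂` for all `G ≤ K` (`J₁, J₂ ≥ 0`), then `S(x,y) ≠ 0 ⇒ |Φ y − Φ x| ≤ J₁ + J₂` (a swap moves `G` by at most one
and flips the hub indicator accordingly; a redraw keeps `G`). [ours] -/
theorem pair_step_jump (hinj : ∀ x x', hub x = hub x' → comp x = comp x' → x = x') (hhub : ∀ x, comp x (hub x) ≠ 0) (hsum : ∀ x, ∑ v, comp x v = K + 1)
    (hA : ∀ x x', Ast x x' = if comp x' = comp x then Kh (comp x) (hub x) (hub x') else 0)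
    (hB : ∀ x x', Bst x x' = μ0 (hub x') * (if comp x' + Pi.single (hub x) 1 = comp x + Pi.single (hub x') 1 then 1 else 0))
    (hS : ∀ x x', Sst x x' = σ * Ast x x' + (1 - σ) * Bst x x')
    (hG : ∀ x, Gc x = comp x u - (if hub x = u then 1 else 0)) (hΦ : ∀ x, Φ x = F (Gc x) + (if hub x = u then H (Gc x) else 0))
    {J₁ J₂ : ℝ} (hJ₁0 : 0 ≤ J₁) (hJ₂0 : 0 ≤ J₂) (hJ₁ : ∀ G : ℕ, G ≤ K → |F (G + 1) - F G| ≤ J₁) (hJ₂ : ∀ G : ℕ, G ≤ K → |H G| ≤ J₂)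
    (x y : X) (hxy : Sst x y ≠ 0) : |Φ y - Φ x| ≤ J₁ + J₂ := by
  have hGx : Gc x ≤ K := by rw [hG]; exact coldCount_le hhub hsum u x
  have hGy : Gc y ≤ K := by rw [hG]; exact coldCount_le hhub hsum u y
  rw [hΦ, hΦ]
  by_cases hc : comp y = comp x
  · by_cases hx : hub x = u <;> by_cases hy : hub y = u
    · have : y = x := hinj y x (hy.trans hx.symm) hc
      subst this; rw [sub_self, abs_zero]; positivity
    · rw [if_pos hx, if_neg hy, add_zero, pair_coldCount_swap_from_u hhub hG hc hx hy]
      calc |F (Gc x + 1) - (F (Gc x) + H (Gc x))| = |(F (Gc x + 1) - F (Gc x)) + (-H (Gc x))| := by ring_nf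
        _ ≤ |F (Gc x + 1) - F (Gc x)| + |-H (Gc x)| := abs_add_le _ _
        _ ≤ J₁ + J₂ := by rw [abs_neg]; exact add_le_add (hJ₁ _ hGx) (hJ₂ _ hGx)
    · rw [if_neg hx, if_pos hy, add_zero]
      have h := pair_coldCount_swap_to_u hhub hG hc hx hy
      have e : Gc x = Gc y + 1 := h.symm
      rw [e]
      calc |F (Gc y) + H (Gc y) - F (Gc y + 1)| = |-(F (Gc y + 1) - F (Gc y)) + H (Gc y)| := by ring_nf
        _ ≤ |-(F (Gc y + 1) - F (Gc y))| + |H (Gc y)| := abs_add_le _ _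
        _ ≤ J₁ + J₂ := by rw [abs_neg]; exact add_le_add (hJ₁ _ hGy) (hJ₂ _ hGy)
    · rw [if_neg hx, if_neg hy, add_zero, add_zero, pair_coldCount_swap_kept hG hc ⟨fun h => absurd h hx, fun h => absurd h hy⟩, sub_self, abs_zero]
      positivity
  · -- a redraw: `G` is kept, the hub indicator may flip
    have hr : comp y + Pi.single (hub x) 1 = comp x + Pi.single (hub y) 1 := by
      by_contra hr
      apply hxy
      rw [hS, hA, if_neg hc, hB, if_neg hr]; ring
    have hk : Gc y = Gc x := by rw [hG, hG]; exact coldCount_redraw hhub u hr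
    rw [hk]
    by_cases hx : hub x = u <;> by_cases hy : hub y = u
    · rw [if_pos hx, if_pos hy, sub_self, abs_zero]; positivity
    · rw [if_pos hx, if_neg hy, add_zero]
      calc |F (Gc x) - (F (Gc x) + H (Gc x))| = |H (Gc x)| := by rw [show F (Gc x) - (F (Gc x) + H (Gc x)) = -H (Gc x) by ring, abs_neg]
        _ ≤ J₁ + J₂ := by linarith [hJ₂ _ hGx]
    · rw [if_neg hx, if_pos hy, add_zero]
      calc |F (Gc x) + H (Gc x) - F (Gc x)| = |H (Gc x)| := by rw [show F (Gc x) + H (Gc x) - F (Gc x) = H (Gc x) by ring]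
        _ ≤ J₁ + J₂ := by linarith [hJ₂ _ hGx]
    · rw [if_neg hx, if_neg hy, sub_self, abs_zero]; positivity

omit [DecidableEq X] in
/-- **WILSON'S INCREMENT BOUND:** under the same jump hypotheses, `Σ_y S(x,y)(Φ y − Φ x)² ≤ (J₁ + J₂)²` for every `x` (`S ≥ 0` with unit rows). [ours] -/
theorem pair_step_sq_increment (hinj : ∀ x x', hub x = hub x' → comp x = comp x' → x = x') (hhub : ∀ x, comp x (hub x) ≠ 0) (hsum : ∀ x, ∑ v, comp x v = K + 1)
    (hA : ∀ x x', Ast x x' = if comp x' = comp x then Kh (comp x) (hub x) (hub x') else 0)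
    (hB : ∀ x x', Bst x x' = μ0 (hub x') * (if comp x' + Pi.single (hub x) 1 = comp x + Pi.single (hub x') 1 then 1 else 0))
    (hS : ∀ x x', Sst x x' = σ * Ast x x' + (1 - σ) * Bst x x') (hSrs : IsRowStochastic Sst)
    (hG : ∀ x, Gc x = comp x u - (if hub x = u then 1 else 0)) (hΦ : ∀ x, Φ x = F (Gc x) + (if hub x = u then H (Gc x) else 0))
    {J₁ J₂ : ℝ} (hJ₁0 : 0 ≤ J₁) (hJ₂0 : 0 ≤ J₂) (hJ₁ : ∀ G : ℕ, G ≤ K → |F (G + 1) - F G| ≤ J₁) (hJ₂ : ∀ G : ℕ, G ≤ K → |H G| ≤ J₂) (x : X) :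
    ∑ y, Sst x y * (Φ y - Φ x) ^ 2 ≤ (J₁ + J₂) ^ 2 := by
  have key : ∀ y, Sst x y * (Φ y - Φ x) ^ 2 ≤ Sst x y * (J₁ + J₂) ^ 2 := by
    intro y
    by_cases h0 : Sst x y = 0
    · rw [h0, zero_mul, zero_mul]
    · refine mul_le_mul_of_nonneg_left ?_ (hSrs.1 x y)
      have hj := pair_step_jump hinj hhub hsum hA hB hS hG hΦ hJ₁0 hJ₂0 hJ₁ hJ₂ x y h0
      rw [← sq_abs]
      exact pow_le_pow_left₀ (abs_nonneg _) hj 2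
  calc ∑ y, Sst x y * (Φ y - Φ x) ^ 2 ≤ ∑ y, Sst x y * (J₁ + J₂) ^ 2 := sum_le_sum fun y _ => key y
    _ = (J₁ + J₂) ^ 2 := by rw [← sum_mul, hSrs.2 x, one_mul]

omit [Fintype X] [DecidableEq X] [Fintype S] [DecidableEq S] in
/-- **THE PATTERN FROM THE PERSISTENCE:** if `W` is constant (`= W₂`) off `u`, then `acc(u,v) = min{1, W_u/W₂}` and `acc(v,u) = min{1, W₂/W_u}` for all `v ≠ u`, both in `(0,1]`
(two contents always qualify). [ours] -/
theorem pair_pattern_of_persistence {W : S → ℝ} (hW : ∀ v, 0 < W v) (hacc : ∀ h v, acc h v = min 1 (W h / W v)) {W₂ : ℝ} (hW2 : ∀ v, v ≠ u → W v = W₂) :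
    (∀ v, v ≠ u → acc u v = min 1 (W u / W₂)) ∧ (∀ v, v ≠ u → acc v u = min 1 (W₂ / W u))
      ∧ (∀ v, v ≠ u → 0 < min 1 (W u / W₂) ∧ min 1 (W u / W₂) ≤ 1 ∧ 0 < min 1 (W₂ / W u) ∧ min 1 (W₂ / W u) ≤ 1) := by
  refine ⟨fun v hv => by rw [hacc, hW2 v hv], fun v hv => by rw [hacc, hW2 v hv], fun v hv => ?_⟩
  have h2 : 0 < W₂ := by rw [← hW2 v hv]; exact hW v
  exact ⟨lt_min one_pos (div_pos (hW u) h2), min_le_left _ _, lt_min one_pos (div_pos h2 (hW u)), min_le_left _ _⟩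

end PairLumping

end Summit.Ventures.LatticeQCDFlow.Scaling

end
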